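import Summits.Langlands.Langlands.Theorems.RamifiedCoefficientSeedAdjointLiftingGL3BirthDefs2
import Literature.NumberTheory.Automorphic.PairLFunctionMeromorphicContinuationRankNeTwistProofs
import HarnessLib
import Literature.NumberTheory.Automorphic.GelbartJacquetAdjointLiftArchimedean

/-!
# Route `RamifiedCoefficientSeed`, crux `AdjointLiftingGL3` (stmt-Langlands-16779), line `birth`:
# stub S5 — the automorphic adjoint seed `π₀ = Ad(π_g) ⊗ χ` on `GL₃(𝔸_ℚ)`

The purely automorphic half of the weight-zero seed of the line (skeleton v4, stub S5,
`AutomorphicAdjointSeed p` of the line vocabulary `…BirthDefs2`): from a newform `g ∈ S₂(Γ₁(M))`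
with `p ∤ M`, a cuspidal `π` on `GL₂(𝔸_ℚ)` attached to `g` (Harish-Chandra parameter
`{1/2, -1/2}`) admitting NO almost-everywhere quadratic self-twist, and a finite-order Hecke
character `χ` unramified above `p`, produce a cuspidal `π₀` on `GL₃(𝔸_ℚ)` of WEIGHT ZERO whose
Satake parameter is `χ(ϖ_v) · Ad(t_{π,v})` at EVERY place `v ∣ p` (so `π₀` is unramified at `p`)
and at almost every place.

On paper `π₀ := Ad(π) ⊗ (χ ∘ det)`:

* **Gelbart–Jacquet, pointwise.** The tree carries the adjoint lift `GL(2) → GL(3)` only in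
  almost-everywhere forms (`GelbartJacquet_adjoint_lift`,
  `GelbartJacquet_adjoint_lift_archimedean`), which cannot see the single place `p`.  The
  theorem they quote (Gelbart–Jacquet 1978, Thm. (9.3) (2)–(3) with (3.5)) is a statement at
  EVERY place: "(2) for any place `v` the representation `σ_v` admits a lift `π_v` to
  `G_{3,v}`; (3) set `π = ⊗ π_v` (all `v`). Then `π` is automorphic
  cuspidal", and by (3.5) the lift of a quasi-unramified `σ_v = π(μ₁, μ₂)` is unramified with
  `t_{π,v} = Ad(t_{σ,v})`.  This POINTWISE form is vendored here as the named fact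
  `GelbartJacquet_adjoint_lift_pointwise` (same shape as `GelbartJacquet_adjoint_lift_archimedean`
  with `∀ v` in place of `∀ᶠ v`; it implies both tree facts,
  `gelbartJacquet_adjoint_lift_archimedean_of_pointwise`,
  `gelbartJacquet_adjoint_lift_of_pointwise`), and the stub is proved CONDITIONALLY on it:
  `automorphicSeed_of_GJ`.
* **Weight zero.** The archimedean clause turns the parameter `{1/2, -1/2}` of `π` into
  `{1/2 - (-1/2), -1/2 - 1/2, 0} = {1, -1, 0}` (`adArch_weightTwo`), which is the multiset
  `{ρ₀, ρ₁, ρ₂} = {1, 0, -1}` of `a`-exponents of the weight-zero infinity type of `GL₃ / ℚ`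
  (`map_a_weightZeroInfinityType_three`; `isWellFormed_weightZeroInfinityType`), i.e.
  `Ad(π)` `HasWeightZero`; a finite-order twist does not move the archimedean parameter
  (`AutomorphicRepData.HasArchParameter.twist`).
* **The twist.** `π₀ := (Ad π).twist χ hχ` (`CuspidalAutomorphicRepData.twist`, Borel–Jacquet /
  Arthur–Clozel); at a place `v ∣ p`, `χ` is unramified, so `χ ∘ det` has a level PRIME TO `v`
  (`HeckeCharacter.exists_level_not_dvd_of_isUnramifiedAt`) and
  `t_{π₀,v} = χ(ϖ_v) · Ad(t_{π,v})` (`HasSatakeParamAt.twist_of_isUnramifiedAt`); almost everywhere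
  the same holds by `AutomorphicRepData.eventually_hasSatakeParamAt_twist`.

References: [GelbartJacquet1978] S. Gelbart, H. Jacquet, *A relation between automorphic
representations of GL(2) and GL(3)*, Ann. Sci. ÉNS (4) 11 (1978), 471–542, Def. (3.1.3),
Prop. (3.2), (3.5), Thm. (9.3), Remark (9.9); [Gelbart1997] S. Gelbart, *Three lectures …* (1997),
Thm. 5.3.2; [ArthurClozelAMS120] Ch. 3, proof of Thm. 3.1 (p. 172); [Clozel1990] §3.5.
-/

set_option linter.dupNamespace false -- `Summit.Langlands.Langlands` is the mandated namespace

noncomputable section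

namespace Summit.Langlands.Langlands.Cruxes.AdjointLiftingGL3.Birth

open scoped MatrixGroups NumberField
open NumberField IsDedekindDomain Field Filter
open Literature.NumberTheory.GaloisRepresentations
open Literature.NumberTheory.Automorphic

/-! ## The named fact: Gelbart–Jacquet's adjoint lift, at every place -/

/-- The pointwise Gelbart–Jacquet fact implies the tree's almost-everywhere fact with the
archimedean clause (`∀ v` gives `∀ᶠ v`). [cite: GelbartJacquet1978, Thm. (9.3) (2)–(3)] -/
theorem gelbartJacquet_adjoint_lift_archimedean_of_pointwise
    (h : Literature.NumberTheory.Automorphic.GelbartJacquet_adjoint_lift_pointwise) : GelbartJacquet_adjoint_lift_archimedean := by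
  intro F _ _ hF hF3 π hπ
  obtain ⟨P, hS, hA⟩ := h F hF hF3 π hπ
  exact ⟨P, Filter.Eventually.of_forall fun v α hα => hS v α hα, hA⟩

/-- The pointwise Gelbart–Jacquet fact implies the tree's Satake-only almost-everywhere fact
`GelbartJacquet_adjoint_lift`. [cite: GelbartJacquet1978, Thm. (9.3) (2)–(3)] -/
theorem gelbartJacquet_adjoint_lift_of_pointwise
    (h : Literature.NumberTheory.Automorphic.GelbartJacquet_adjoint_lift_pointwise) : GelbartJacquet_adjoint_lift := by
  intro F _ _ hF hF3 π hπ
  obtain ⟨P, hS, -⟩ := h F hF hF3 π hπ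
  exact ⟨P, Filter.Eventually.of_forall fun v α hα => hS v α hα⟩

/-! ## Weight zero for `GL₃ / ℚ`: `{ρ₀, ρ₁, ρ₂} = {1, 0, -1} = Ad{1/2, -1/2}` -/

/-- The `a`-exponents of the weight-zero infinity type of `GL₃ / ℚ` are `{ρ₀, ρ₁, ρ₂} = {1, 0, -1}`
(`ρ_i = (n - 1)/2 - i`, `n = 3`). [cite: Clozel1990, §3.5 and Lemme 3.14] -/
theorem map_a_weightZeroInfinityType_three (σ : ℚ →+* ℂ) :
    (weightZeroInfinityType 3 ℚ σ).map ArchWeight.a = ({1, 0, -1} : Multiset ℂ) := by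
  simp only [weightZeroInfinityType_apply, Multiset.map_map, Function.comp_def,
    weightZeroArchWeight_a]
  rw [Fin.univ_val_map]
  simp [rhoGL]
  norm_num
  rfl

/-- **`Ad` of the weight-`2` archimedean parameter is the weight-zero parameter of `GL₃`**:
`{a - b : (a, b) ∈ χ × χ} ∖ {0} = {1, 0, -1}` for `χ = {1/2, -1/2}` (the four differences are
`0, 1, -1, 0`; one `0` is removed) — Gelbart–Jacquet's (3.2.2) `τ ⊗ τ̃ = λ ⊕ 1` on exponents.
[cite: GelbartJacquet1978, Prop. (3.2), (3.2.2)] -/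
theorem adArch_weightTwo :
    (((({(((2 : ℤ) : ℂ) - 1) / 2, (1 - ((2 : ℤ) : ℂ)) / 2} : Multiset ℂ) ×ˢ
        ({(((2 : ℤ) : ℂ) - 1) / 2, (1 - ((2 : ℤ) : ℂ)) / 2} : Multiset ℂ)).map
          fun p => p.1 - p.2).erase 0) = ({1, 0, -1} : Multiset ℂ) := by
  simp [Multiset.insert_eq_cons, Multiset.cons_product]
  norm_num
  exact Multiset.cons_swap _ _ _

/-! ## The stub, conditional on the pointwise Gelbart–Jacquet fact -/

/-- **The automorphic adjoint seed `π₀ = Ad(π) ⊗ χ`** (stub S5 of the line, conditional on the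
vendored pointwise Gelbart–Jacquet lift): for `g ∈ S₂(Γ₁(M))` a newform with `p ∤ M`, `π` cuspidal
on `GL₂(𝔸_ℚ)` with Harish-Chandra parameter `{1/2, -1/2}` and no a.e. quadratic self-twist, and `χ`
a finite-order Hecke character unramified above `p`, the cuspidal `π₀ := (Ad π) ⊗ (χ ∘ det)` on
`GL₃(𝔸_ℚ)` has weight zero (archimedean parameter `Ad{1/2, -1/2} = {1, 0, -1} = {ρ_i}`, unchanged
by the finite-order twist), Satake parameter `χ(ϖ_v) · Ad(t_{π,v})` at every `v ∣ p` (pointwise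
Gelbart–Jacquet at `v`, then the twist at a level of `χ ∘ det` prime to `v`, which exists as `χ`
is unramified at `v`) and at almost every `v` (Arthur–Clozel: `t_{P ⊗ χ, v} = χ(ϖ_v) t_{P,v}`
off the level and the ramification of `χ`).
[cite: GelbartJacquet1978, Thm. (9.3) (2)–(3), (3.5), Prop. (3.2)]
[cite: ArthurClozelAMS120, Ch. 3, proof of Thm. 3.1 (p. 172)] -/
theorem automorphicSeed_of_GJ :
    Literature.NumberTheory.Automorphic.GelbartJacquet_adjoint_lift_pointwise → ∀ (p : ℕ) [Fact p.Prime], AutomorphicAdjointSeed p := by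
  intro hGJ p _ hcpt₂ hcpt₃ M _ g _ _ π _ hπA hnst χ hχ hχur
  obtain ⟨P, hPS, hPA⟩ := hGJ ℚ hcpt₂ hcpt₃ π hnst
  refine ⟨P.twist χ hχ, ?_, ?_, ?_⟩
  · -- weight zero: `Ad{1/2, -1/2} = {1, 0, -1} = {ρ₀, ρ₁, ρ₂}`, preserved by the twist
    refine ⟨isWellFormed_weightZeroInfinityType 3 ℚ, ?_⟩
    have h := hPA _ hπA
    have hfun : (fun σ : ℚ →+* ℂ => (weightZeroInfinityType 3 ℚ σ).map ArchWeight.a) =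
        fun _ => (((({(((2 : ℤ) : ℂ) - 1) / 2, (1 - ((2 : ℤ) : ℂ)) / 2} : Multiset ℂ) ×ˢ
          ({(((2 : ℤ) : ℂ) - 1) / 2, (1 - ((2 : ℤ) : ℂ)) / 2} : Multiset ℂ)).map
            fun p => p.1 - p.2).erase 0) := by
      funext σ
      rw [map_a_weightZeroInfinityType_three, adArch_weightTwo]
    rw [CuspidalAutomorphicRepData.twist_val, hfun]
    exact AutomorphicRepData.HasArchParameter.twist (π := P.1) χ hχ h
  · -- at `v ∣ p`: pointwise Gelbart–Jacquet, then the twist at a level of `χ ∘ det` prime to `v`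
    intro v hv α hα
    obtain ⟨𝔪, h𝔪, hv𝔪, hχ𝔪⟩ :=
      HeckeCharacter.exists_level_not_dvd_of_isUnramifiedAt 3 (hχur v hv)
    rw [CuspidalAutomorphicRepData.twist_val]
    exact (hPS v α hα).twist_of_isUnramifiedAt hχ h𝔪 hχ𝔪 hv𝔪 (hχur v hv)
  · -- almost everywhere: off the level and the ramification of `χ`
    filter_upwards [P.1.eventually_hasSatakeParamAt_twist hχ] with v hv α hα
    exact hv _ (hPS v α hα)

end Summit.Langlands.Langlands.Cruxes.AdjointLiftingGL3.Birth

end
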